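import Summits.HodgeConjecture.HodgeConjecture.Theorems.MarkmanPartnerTransportPicardThreeK3SquaresOneCycleDegreeHodge
import Summits.HodgeConjecture.HodgeConjecture.Theorems.MarkmanPartnerTransportPicardThreeK3SquaresIsogenyInvariance
import Summits.HodgeConjecture.HodgeConjecture.Theorems.MarkmanPartnerTransportPartnerTransport

/-!
# Route MarkmanPartnerTransport · crux `PicardThreeK3Squares` (stmt-HodgeConjecture-19652) —
# ONE CYCLE SUFFICES, part 8: consequences — isogenous K3 surfaces and Hilbert squares

Two compositions of the line «one cycle suffices» (parts 1–7) with existing route theorems: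

* `hodgeConjectureFor_square_of_markedIsometry_of_oneCycle` — **isogeny closure**: if a marked
  projective K3 surface `S'` with `ρ(S') ∉ {2, 4, 6, 10}` carries ONE cycle-induced rational Hodge
  endomorphism acting on its `2`-form by a non-rational scalar, then `HodgeConjectureFor 4 (S ⊗ S)` for
  every marked projective K3 surface `S` ISOGENOUS to `S'` (a rational isometry `σ` of `Λ_ℂ` carrying the
  period of `S'` into the period line of `S`) — by `IsogenyInvariance.hodgeConjectureFor_square_of_markedIsometry`
  (mod Buskin's Thm. 1.1, which the one-cycle theorem uses for its CM branch anyway, and markings);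
* `hodgeConjectureFor_hilbertSquare_of_oneCycle` / `…_of_six_mul_lt` — **Hilbert squares**: the same
  single cycle on `S` gives `HodgeConjectureFor 4 H` for the Hilbert square `H = S^{[2]}`
  (`PartnerLattice.hodgeConjectureFor_hilbertSquare_of_square`, mod Beauville's blow-up description); in
  the degree form (`22 - ρ(S) < 6k`) this reaches `ρ(S) = 2`, i.e. fourfolds `H` with `ρ(H) = 3` INSIDE
  the range of crux #5 `LowPicardRealMultiplication` — e.g. the Hilbert squares of van Geemen–Schütt's
  `ℚ(ζ₁₁ + ζ₁₁⁻¹)` surfaces (quintic eigenvalue, `30 > 20`) need only the one cycle `Γ₁ + Γ₋₁`, not the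
  identification of `End_Hdg T(S)`.

No definition, no sorry; named facts {`Buskin2019_hodgeIsometry_algebraic`, `Huybrechts_K3_marking_exists`,
`Beauville1983_hilbertSquare_blowupDiagonal_surjection`} only as hypotheses. Prover seat
hodge-nonav-19652-p1 (gen 8), `--supports stmt-HodgeConjecture-19652`. Nothing here proves the crux or
the Hodge conjecture.

References: Buskin, J. reine angew. Math. 755 (2019), Thm. 1.1; Huybrechts, Comment. Math. Helv. 94
(2019), Thm. 0.2; Beauville, J. Differential Geom. 18 (1983), §6; van Geemen–Schütt, Forum Math. Sigma
13 (2025) e2, Thm. 1.1 (11), §4.8; Varesco, Math. Z. 305 (2023), §2.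
-/

set_option linter.dupNamespace false

noncomputable section

namespace Summit.HodgeConjecture.HodgeConjecture.Theorems.MarkmanPartnerTransport.OneCycle

open scoped Manifold TensorProduct
open Module CategoryTheory MonoidalCategory CartesianMonoidalCategory Polynomial
open Literature.AlgebraicGeometry Literature.AlgebraicGeometry.Motives Literature.AlgebraicGeometry.HodgeTheory
open Literature.AlgebraicGeometry.Hyperkaehler Literature.AlgebraicGeometry.HilbertScheme
open Literature.AlgebraicGeometry.Surfaces
open Literature.AlgebraicTopology.SingularHomology
open Summit.HodgeConjecture.HodgeConjecture.Theorems
open Summit.HodgeConjecture.HodgeConjecture.Theorems.NikulinTwinTransport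

/-- `Corr[μ, hS ; γ, y] = pr₁_*(pr₂^* y ∪ γ)` on `H²(S(ℂ); ℂ)`. Local notation only. -/
local notation3 (prettyPrint := false) "Corr[" μ ", " hS " ; " γ ", " y "]" =>
  complexGysin μ (IsSmoothProjective.tensor_holds hS hS) hS
    (SemiCartesianMonoidalCategory.fst _ _) (rfl : 2 * 1 + 2 * 2 + 2 * 2 = 2 * 1 + 2 * (2 + 2))
    (cupProduct (rfl : 2 * 1 + 2 * 2 = 2 * 1 + 2 * 2)
      (complexBetti.map (SemiCartesianMonoidalCategory.snd _ _) (2 * 1) y) γ)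

variable {S S' H : SchemeOver ℂ}

/-! ### Isogeny closure of the one-cycle sector -/

/-- **One cycle on `S'` settles HC⁴ for the square of every K3 surface ISOGENOUS to `S'`.** Let `S, S'` be
projective K3 surfaces marked by `(η, p, x)`, `(η', p', x')` (integral generator of `H⁴`, integral
lattice and cup form through the marking, `(2,0)`-period with `(x̄.x) > 0`), `σ` a rational isometry of
`(Λ_ℂ, k3Form)` with `σ x' ∈ ℂ x` («`S` and `S'` are isogenous», Huybrechts 2019). If
`ρ(S') ∉ {2, 4, 6, 10}` and `S'` carries an endomorphism `e` of `H²(S'(ℂ); ℂ)` preserving rational classes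
and Hodge types, induced by an algebraic class on `S' × S'`, with a non-rational eigenvalue on a non-zero
`(2,0)`-class, then `HodgeConjectureFor 4 (S ⊗ S)`: `hodgeConjectureFor_square_of_oneCycle_of_picard` on
`S'`, transported by `IsogenyInvariance.hodgeConjectureFor_square_of_markedIsometry` (Buskin).
[cite: Buskin2019, Thm. 1.1] [cite: Huybrechts2019, Thm. 0.2] [cite: GeemenSchutt2023, §4.8 and Rem. 4.9] -/
theorem hodgeConjectureFor_square_of_markedIsometry_of_oneCycle (hB : Buskin2019_hodgeIsometry_algebraic)
    (hmark : Huybrechts_K3_marking_exists) (hS : IsK3Surface S) (hS' : IsK3Surface S')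
    (η : complexBetti S (2 * 1) ≃ₗ[ℂ] (K3Index → ℂ)) (p : complexBetti S (2 * 2)) (x : K3Index → ℂ)
    (η' : complexBetti S' (2 * 1) ≃ₗ[ℂ] (K3Index → ℂ)) (p' : complexBetti S' (2 * 2))
    (x' : K3Index → ℂ)
    (hp : IsIntegralClass p ∧ ∀ q : complexBetti S (2 * 2), IsIntegralClass q → ∃ n : ℤ, q = n • p)
    (hηint : ∀ c : complexBetti S (2 * 1),
      IsIntegralClass c ↔ ∃ v : K3Index → ℤ, η c = fun i => (v i : ℂ))
    (hηcup : ∀ a b : complexBetti S (2 * 1),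
      cupProduct (rfl : 2 * 1 + 2 * 1 = 2 * 2) a b = k3Form (η a) (η b) • p)
    (h20 : IsOfHodgeType 2 S (2 * 1) 2 0 (η.symm x)) (hx : 0 < (k3Form (star x) x).re)
    (hp' : IsIntegralClass p' ∧ ∀ q : complexBetti S' (2 * 2), IsIntegralClass q → ∃ n : ℤ, q = n • p')
    (hη'int : ∀ c : complexBetti S' (2 * 1),
      IsIntegralClass c ↔ ∃ v : K3Index → ℤ, η' c = fun i => (v i : ℂ))
    (hη'cup : ∀ a b : complexBetti S' (2 * 1),
      cupProduct (rfl : 2 * 1 + 2 * 1 = 2 * 2) a b = k3Form (η' a) (η' b) • p')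
    (h20' : IsOfHodgeType 2 S' (2 * 1) 2 0 (η'.symm x')) (hx' : 0 < (k3Form (star x') x').re)
    (σ : Module.End ℂ (K3Index → ℂ)) (hσ : ∀ a b, k3Form (σ a) (σ b) = k3Form a b)
    (hσrat : ∀ v : K3Index → ℤ, ∃ w : K3Index → ℚ, σ (fun i => (v i : ℂ)) = fun i => (w i : ℂ))
    (hper : ∃ t : ℂ, σ x' = t • x)
    (h2 : Module.finrank ℂ ↥(algebraicClasses S' 1) ≠ 2) (h4 : Module.finrank ℂ ↥(algebraicClasses S' 1) ≠ 4)
    (h6 : Module.finrank ℂ ↥(algebraicClasses S' 1) ≠ 6) (h10 : Module.finrank ℂ ↥(algebraicClasses S' 1) ≠ 10)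
    (μ : OrientationFamily) (e : complexBetti S' (2 * 1) →ₗ[ℂ] complexBetti S' (2 * 1))
    (he_rat : ∀ y, IsRationalClass y → IsRationalClass (e y))
    (he_typ : ∀ (i j : ℕ) y, IsOfHodgeType 2 S' (2 * 1) i j y → IsOfHodgeType 2 S' (2 * 1) i j (e y))
    (he_cyc : ∃ γ ∈ algebraicClasses (S' ⊗ S') 2, ∀ y : complexBetti S' (2 * 1),
      e y = Corr[μ, hS'.isSmoothProjective ; γ, y])
    (he_ev : ∃ (σ₀ : complexBetti S' (2 * 1)) (ev : ℂ), IsOfHodgeType 2 S' (2 * 1) 2 0 σ₀ ∧ σ₀ ≠ 0 ∧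
      e σ₀ = ev • σ₀ ∧ ∀ a : ℚ, (a : ℂ) ≠ ev) :
    HodgeConjectureFor 4 (S ⊗ S) :=
  IsogenyInvariance.hodgeConjectureFor_square_of_markedIsometry hB hS hS' η p x η' p' x' hp hηint hηcup
    h20 hx hp' hη'int hη'cup h20' hx' σ hσ hσrat hper
    (hodgeConjectureFor_square_of_oneCycle_of_picard hB hmark hS' h2 h4 h6 h10 μ e he_rat he_typ he_cyc he_ev)

/-! ### Hilbert squares -/

/-- **One cycle on `S` settles HC⁴ for the Hilbert square `S^{[2]}`** (`ρ(S) ∉ {2, 4, 6, 10}`; mod Buskin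
for the CM branch, markings, and Beauville's blow-up description of `S^{[2]}`):
`hodgeConjectureFor_square_of_oneCycle_of_picard` and `PartnerLattice.hodgeConjectureFor_hilbertSquare_of_square`.
[cite: Beauville1983, §6] [cite: GeemenSchutt2023, §4.8 and Rem. 4.9] [cite: Buskin2019, Thm. 1.1] -/
theorem hodgeConjectureFor_hilbertSquare_of_oneCycle (hB : Buskin2019_hodgeIsometry_algebraic)
    (hmark : Huybrechts_K3_marking_exists) (hBl : Beauville1983_hilbertSquare_blowupDiagonal_surjection)
    (hS : IsK3Surface S) {Ξ : (S ⊗ H).left.IdealSheafData} (hHilb : IsHilbertSchemeOfPoints 2 S H Ξ)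
    (hH : IsSmoothProjective 4 H)
    (h2 : Module.finrank ℂ ↥(algebraicClasses S 1) ≠ 2) (h4 : Module.finrank ℂ ↥(algebraicClasses S 1) ≠ 4)
    (h6 : Module.finrank ℂ ↥(algebraicClasses S 1) ≠ 6) (h10 : Module.finrank ℂ ↥(algebraicClasses S 1) ≠ 10)
    (μ : OrientationFamily) (e : complexBetti S (2 * 1) →ₗ[ℂ] complexBetti S (2 * 1))
    (he_rat : ∀ y, IsRationalClass y → IsRationalClass (e y))
    (he_typ : ∀ (i j : ℕ) y, IsOfHodgeType 2 S (2 * 1) i j y → IsOfHodgeType 2 S (2 * 1) i j (e y))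
    (he_cyc : ∃ γ ∈ algebraicClasses (S ⊗ S) 2, ∀ y : complexBetti S (2 * 1),
      e y = Corr[μ, hS.isSmoothProjective ; γ, y])
    (he_ev : ∃ (σ₀ : complexBetti S (2 * 1)) (ev : ℂ), IsOfHodgeType 2 S (2 * 1) 2 0 σ₀ ∧ σ₀ ≠ 0 ∧
      e σ₀ = ev • σ₀ ∧ ∀ a : ℚ, (a : ℂ) ≠ ev) :
    HodgeConjectureFor 4 H :=
  PartnerLattice.hodgeConjectureFor_hilbertSquare_of_square hBl hS.isSmoothProjective hHilb hH
    (hodgeConjectureFor_square_of_oneCycle_of_picard hB hmark hS h2 h4 h6 h10 μ e he_rat he_typ he_cyc he_ev)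

/-- **Degree form for Hilbert squares, reaching `ρ(S) = 2` (fourfolds with `ρ(H) = 3` inside the range of
crux `LowPicardRealMultiplication`)**: if `S` carries one cycle-induced rational Hodge endomorphism whose
`(2,0)`-eigenvalue has minimal polynomial of degree `k` with `22 - ρ(S) < 6k` — e.g. the quintic
`2cos(2π/11)` at `ρ(S) = 2` (van Geemen–Schütt Thm. 1.1 (11), cycle `Γ₁ + Γ₋₁`) — then
`HodgeConjectureFor 4 H` for the Hilbert square `H = S^{[2]}`.
[cite: GeemenSchutt2023, Thm. 1.1 (11) and §4.8] [cite: Beauville1983, §6] [cite: Buskin2019, Thm. 1.1] -/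
theorem hodgeConjectureFor_hilbertSquare_of_oneCycle_of_six_mul_lt (hB : Buskin2019_hodgeIsometry_algebraic)
    (hmark : Huybrechts_K3_marking_exists) (hBl : Beauville1983_hilbertSquare_blowupDiagonal_surjection)
    (hS : IsK3Surface S) {Ξ : (S ⊗ H).left.IdealSheafData} (hHilb : IsHilbertSchemeOfPoints 2 S H Ξ)
    (hH : IsSmoothProjective 4 H) {k : ℕ} (hk : 22 < 6 * k + Module.finrank ℂ ↥(algebraicClasses S 1))
    (μ : OrientationFamily) (e : complexBetti S (2 * 1) →ₗ[ℂ] complexBetti S (2 * 1))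
    (he_rat : ∀ y, IsRationalClass y → IsRationalClass (e y))
    (he_typ : ∀ (i j : ℕ) y, IsOfHodgeType 2 S (2 * 1) i j y → IsOfHodgeType 2 S (2 * 1) i j (e y))
    (he_cyc : ∃ γ ∈ algebraicClasses (S ⊗ S) 2, ∀ y : complexBetti S (2 * 1),
      e y = Corr[μ, hS.isSmoothProjective ; γ, y])
    (he_ev : ∃ (σ₀ : complexBetti S (2 * 1)) (ev : ℂ), IsOfHodgeType 2 S (2 * 1) 2 0 σ₀ ∧ σ₀ ≠ 0 ∧
      e σ₀ = ev • σ₀ ∧ (minpoly ℚ ev).natDegree = k) :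
    HodgeConjectureFor 4 H :=
  PartnerLattice.hodgeConjectureFor_hilbertSquare_of_square hBl hS.isSmoothProjective hHilb hH
    (hodgeConjectureFor_square_of_oneCycle_of_six_mul_lt hB hmark hS hk μ e he_rat he_typ he_cyc he_ev)

end Summit.HodgeConjecture.HodgeConjecture.Theorems.MarkmanPartnerTransport.OneCycle

end
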